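import Summits.Ventures.YMGap.Thresholds.LatticeBakryEmeryIntegration
import HarnessLib

/-!
# Venture YMGap — multi-link Bakry–Émery calculus, Part H:
# per-link Lipschitz functions and the Poincaré inequality in Lipschitz (variance) form

HONEST FRAMING: venture file (cell `pub-ymgap`, track (a), seat p2). For a smooth ambient function
`u` on `(E → M_N(ℂ))` whose restriction to `SU(N)^E` is `L_e`-Lipschitz in the link `e` for the
Frobenius (Hilbert–Schmidt chordal) distance, all other links fixed — the Lipschitz rendering of
cylinder functions used by the tree's Shen–Zhu–Zhu facts (`shenZhuZhu_functionalInequalities`,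
`SZZFunctionalInequalitiesWith`) — we show `Γ(u,u) ≤ ∑_e L_e²` on `SU(N)^E` (`Gam_le_of_linkLipschitz`:
derivative along the one-parameter subgroup `g_e exp(tY)`, `Y ∈ 𝔰𝔲(N)`, bounded by the Lipschitz
constant; Parseval frame bound of `SUNBakryEmeryFrame`). The Lipschitz form of the multi-link
Bakry–Émery Poincaré inequality (`poincare_gibbs_lipschitz`) is deduced in
`LatticeBakryEmeryPoincare.lean`.

## References

* H. Shen, R. Zhu, X. Zhu, CMP 400 (2023) 805–851, Cor. 4.4 (4.11), §2 (Hilbert–Schmidt metric: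
  chords are shorter than arcs, so Frobenius-Lipschitz bounds Riemannian gradients).
* Tree files `SUNBakryEmeryFrame.lean` (`sum_sq_apply_frame_le`), `SUNBakryEmeryPoincare.lean` Part H.
-/

noncomputable section

open scoped Matrix ComplexConjugate BigOperators Matrix.Norms.Frobenius ContDiff Topology
open Matrix Complex Finset MeasureTheory Filter
open Literature.MathematicalPhysics.QuantumFieldTheory
open Literature.MathematicalPhysics.QuantumFieldTheory.SUNBakryEmery
  (FrameIdx frame frame_conjTranspose frame_trace frameGrad frameGrad_conjTranspose frameGrad_trace
   sum_sq_apply_frame frobNorm_frameGrad_sq SUN expSU coe_expSU)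

namespace Summit.Ventures.YMGap

namespace LatticeBakryEmery

universe u

variable {ι : Type u} [Fintype ι] [DecidableEq ι] {N : ℕ}

/-! ### The frame bound from a bound on `𝔰𝔲(N)` only -/

/-- **The frame trick on `𝔰𝔲(N)`**: if `|λ(A)| ≤ M ‖A‖_F` for all `A ∈ 𝔰𝔲(N)`, then
`∑_α λ(Y_α)² ≤ M²` (the proof of `SUNBakryEmery.sum_sq_apply_frame_le` uses the bound only at the
frame gradient `Z_λ ∈ 𝔰𝔲(N)`). -/
theorem sum_sq_apply_frame_le_of_skew (hN : N ≠ 0) (lam : Matrix (Fin N) (Fin N) ℂ →ₗ[ℝ] ℝ) {M : ℝ}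
    (h : ∀ A : Matrix (Fin N) (Fin N) ℂ, Aᴴ = -A → A.trace = 0 → |lam A| ≤ M * frobNorm A) :
    ∑ α, lam (frame α) ^ 2 ≤ M ^ 2 := by
  set s := ∑ α, lam (frame α) ^ 2 with hs
  have hs0 : 0 ≤ s := sum_nonneg fun α _ => sq_nonneg _
  have h1 : s ≤ M * Real.sqrt s := by
    calc s = lam (frameGrad lam) := sum_sq_apply_frame lam
      _ ≤ |lam (frameGrad lam)| := le_abs_self _
      _ ≤ M * frobNorm (frameGrad lam) := h _ (frameGrad_conjTranspose lam) (frameGrad_trace hN lam)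
      _ = M * Real.sqrt s := by
          rw [← Real.sqrt_sq (frobNorm_nonneg (frameGrad lam)), frobNorm_frameGrad_sq hN]
  have h2 : Real.sqrt s * Real.sqrt s ≤ M * Real.sqrt s := by rwa [Real.mul_self_sqrt hs0]
  by_cases hs1 : Real.sqrt s = 0
  · have : s = 0 := by rwa [Real.sqrt_eq_zero hs0] at hs1
    rw [this]; positivity
  · have hpos : 0 < Real.sqrt s := lt_of_le_of_ne (Real.sqrt_nonneg s) (Ne.symm hs1)
    have h3 : Real.sqrt s ≤ M := le_of_mul_le_mul_right h2 hpos
    calc s = Real.sqrt s ^ 2 := (Real.sq_sqrt hs0).symm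
      _ ≤ M ^ 2 := pow_le_pow_left₀ (Real.sqrt_nonneg s) h3 2

/-- **`Γ(u,u) ≤ ∑_e L_e²`** on `SU(N)^E` if every derivative in the link `e` along `𝔰𝔲(N)` is bounded
by `L_e`: `|D_{single_e Y} u(Q)| ≤ L_e ‖Y‖_F` for `Y ∈ 𝔰𝔲(N)`. -/
theorem Gam_le_of_algD_lk_le (hN : N ≠ 0) (u : Cfg ι N → ℝ) (Q : Cfg ι N) {L : ι → ℝ}
    (h : ∀ (e : ι) (Y : Matrix (Fin N) (Fin N) ℂ), Yᴴ = -Y → Y.trace = 0 →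
      |algD (lk e Y) u Q| ≤ L e * frobNorm Y) :
    Gam u u Q ≤ ∑ e, L e ^ 2 := by
  rw [Gam_self_eq_sum_linkFun]
  exact sum_le_sum fun e _ => sum_sq_apply_frame_le_of_skew hN (linkFun u Q e)
    fun A hA hA0 => by rw [linkFun_apply]; exact h e A hA hA0

/-! ### Per-link Lipschitz functions on `SU(N)^E` -/

/-- `u ∘ emb` is `L_e`-Lipschitz in the link `e` for the Frobenius distance, all other links fixed
(the Lipschitz rendering of cylinder functions in the tree's Shen–Zhu–Zhu facts). -/
def LinkLipschitz (u : Cfg ι N → ℝ) (L : ι → ℝ) : Prop :=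
  ∀ (e : ι) (g h : PSU ι N), (∀ e', e' ≠ e → g e' = h e') →
    |u (emb g) - u (emb h)| ≤ L e * suFrobDist (g e) (h e)

omit [Fintype ι] in
/-- `g · mulSingle_e x` changes only the link `e`. -/
theorem mul_mulSingle_apply_of_ne (g : PSU ι N) (e : ι) (x : SUN N) {e' : ι} (he' : e' ≠ e) :
    (g * Pi.mulSingle e x : PSU ι N) e' = g e' := by
  rw [Pi.mul_apply, Pi.mulSingle_eq_of_ne he', mul_one]

omit [Fintype ι] in
/-- The link `e` of `g · mulSingle_e x` is `g_e x`. -/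
theorem mul_mulSingle_apply_self (g : PSU ι N) (e : ι) (x : SUN N) :
    (g * Pi.mulSingle e x : PSU ι N) e = g e * x := by
  rw [Pi.mul_apply, Pi.mulSingle_eq_same]

/-- **The one-parameter subgroups of `SU(N)` are `‖Y‖_F`-Lipschitz** (Frobenius):
`‖exp(tY) - exp(sY)‖_F ≤ ‖Y‖_F |t - s|` for `Y ∈ 𝔲(N)` (mean value inequality; `exp(rY)` is unitary). -/
theorem frobNorm_exp_sub_exp_le {Y : Matrix (Fin N) (Fin N) ℂ} (hY : Yᴴ = -Y) (t s : ℝ) :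
    frobNorm (NormedSpace.exp (t • Y) - NormedSpace.exp (s • Y)) ≤ frobNorm Y * |t - s| := by
  have hdiff : Differentiable ℝ fun r : ℝ => NormedSpace.exp (r • Y) :=
    fun r => (hasDerivAt_exp_smul_const' (𝕂 := ℝ) Y r).differentiableAt
  have hderiv : ∀ r : ℝ, deriv (fun r : ℝ => NormedSpace.exp (r • Y)) r = Y * NormedSpace.exp (r • Y) :=
    fun r => (hasDerivAt_exp_smul_const' (𝕂 := ℝ) Y r).deriv
  have hbound : ∀ r : ℝ, ‖deriv (fun r : ℝ => NormedSpace.exp (r • Y)) r‖₊ ≤ ⟨frobNorm Y, frobNorm_nonneg Y⟩ := by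
    intro r
    rw [hderiv]
    have h1 : ‖Y * NormedSpace.exp (r • Y)‖ = frobNorm Y := by
      rw [← frobNorm_eq_norm, frobNorm_mul_unitary Y (exp_smul_mem_unitaryGroup hY r)]
    exact le_of_eq (Subtype.ext (by simp [h1]))
  have hlip := lipschitzWith_of_nnnorm_deriv_le hdiff hbound
  have h := hlip.dist_le_mul t s
  rw [dist_eq_norm, ← frobNorm_eq_norm, Real.dist_eq] at h
  exact h

/-- **A per-link Lipschitz function has bounded derivatives along `𝔰𝔲(N)^E`**: if `u ∘ emb` is
`L_e`-Lipschitz in the link `e`, then `|D_{single_e Y} u (emb g)| ≤ L_e ‖Y‖_F` for `Y ∈ 𝔰𝔲(N)`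
(differentiate along the one-parameter subgroup `g_e exp(tY) ⊆ SU(N)`). -/
theorem abs_algD_lk_le_of_linkLipschitz {u : Cfg ι N → ℝ} (hu : ContDiff ℝ ∞ u) {L : ι → ℝ}
    (hL : ∀ e, 0 ≤ L e) (hLip : LinkLipschitz u L) (g : PSU ι N) (e : ι)
    {Y : Matrix (Fin N) (Fin N) ℂ} (hY : Yᴴ = -Y) (hY0 : Y.trace = 0) :
    |algD (lk e Y) u (emb g)| ≤ L e * frobNorm Y := by
  -- the curve `t ↦ u(emb g · exp(t single_e Y))` and its derivative at `0`
  have hderiv : HasDerivAt (fun t : ℝ => u (emb g * NormedSpace.exp (t • lk e Y))) (algD (lk e Y) u (emb g)) 0 := by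
    have := hasDerivAt_comp_mul_exp hu (emb g) (lk e Y) 0
    rw [zero_smul, NormedSpace.exp_zero, mul_one] at this
    exact this
  -- the curve is `L_e ‖Y‖_F`-Lipschitz
  have hlip : LipschitzWith ⟨L e * frobNorm Y, mul_nonneg (hL e) (frobNorm_nonneg Y)⟩
      (fun t : ℝ => u (emb g * NormedSpace.exp (t • lk e Y))) := by
    refine LipschitzWith.of_dist_le_mul fun t s => ?_
    rw [Real.dist_eq, Real.dist_eq]
    show |u (emb g * NormedSpace.exp (t • lk e Y)) - u (emb g * NormedSpace.exp (s • lk e Y))| ≤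
      L e * frobNorm Y * |t - s|
    rw [emb_mul_exp_smul_lk g e hY hY0 t, emb_mul_exp_smul_lk g e hY hY0 s]
    have hcfg := hLip e (g * Pi.mulSingle e (expSU hY hY0 t)) (g * Pi.mulSingle e (expSU hY hY0 s))
      (fun e' he' => by rw [mul_mulSingle_apply_of_ne g e _ he', mul_mulSingle_apply_of_ne g e _ he'])
    refine hcfg.trans ?_
    rw [mul_mulSingle_apply_self, mul_mulSingle_apply_self, suFrobDist, mul_assoc]
    refine mul_le_mul_of_nonneg_left ?_ (hL e)
    have : ((g e * expSU hY hY0 t : SUN N) : Matrix (Fin N) (Fin N) ℂ) - ((g e * expSU hY hY0 s : SUN N) : Matrix _ _ ℂ)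
        = (g e : Matrix (Fin N) (Fin N) ℂ) * (NormedSpace.exp (t • Y) - NormedSpace.exp (s • Y)) := by
      simp [Matrix.mul_sub]
    rw [this, frobNorm_unitary_mul (Matrix.specialUnitaryGroup_le_unitaryGroup (g e).2)]
    exact frobNorm_exp_sub_exp_le hY t s
  have := hderiv.le_of_lipschitz hlip
  rw [Real.norm_eq_abs] at this
  exact this

/-- **`Γ(u,u) ≤ ∑_e L_e²` on `SU(N)^E`** for a smooth per-link Lipschitz `u`. -/
theorem Gam_le_of_linkLipschitz (hN : N ≠ 0) {u : Cfg ι N → ℝ} (hu : ContDiff ℝ ∞ u) {L : ι → ℝ}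
    (hL : ∀ e, 0 ≤ L e) (hLip : LinkLipschitz u L) (g : PSU ι N) :
    Gam u u (emb g) ≤ ∑ e, L e ^ 2 :=
  Gam_le_of_algD_lk_le hN u (emb g) fun e _ hY hY0 => abs_algD_lk_le_of_linkLipschitz hu hL hLip g e hY hY0

end LatticeBakryEmery

end Summit.Ventures.YMGap
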